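import Summits.BirchSwinnertonDyer.BirchSwinnertonDyer.Theorems.TeichmullerTwistDescentKOfTameType
import Literature.NumberTheory.ModularSymbols.FullLevelHomologyTwistUp
import HarnessLib

/-!
# Route `TeichmullerTwistDescent`, crux K `TwistedPeriodLatticeSaturation` (stmt-BirchSwinnertonDyer-25368):
# (I1ᴷ) from the CENTRAL-CHARACTER-PINNED tame-type fact — the form of the K-line's automorphic input that does not
# depend on the normalisation of the tree's Hecke operator on parts with non-trivial central character

Cell `pub/bsd-wall` (D-0145 line route-BirchSwinnertonDyer-TeichmullerTwistDescent, OPEN rev 7), seat `bsd-line-ttd-p1`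
(prover 1/2, g27).  THEOREMS ONLY (no definition, no named fact, no `sorry`, no instance, no notation);
`--supports stmt-BirchSwinnertonDyer-25368`.  BSD is not proved by this file; K is NOT proved by this file (it stays
CONDITIONAL); nothing here closes an item.

WHY A SECOND FILE.  `TeichmullerTwistDescentKOfTameType` derives (I1ᴷ) from
`fullLevelHomology_isIsotypic_tamePrincipalSeries`, whose Hecke hypothesis «`Φ ∘ T_q = a_q(W)·Φ` for the TREE's `T_q`» pins the
automorphic part only up to the centre of `GL₂(𝔽_p)`: on `Y(K(p)K₀(M))` the tree's chain-level `T_q` and the adelic `T_q` differ by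
the action of the central element `q̄^{±1}` (sign = push-forward/pull-back convention), so with the unfavourable sign a CUBIC twist
`f_W ⊗ χ̃` (`χ³ = 1`, `3 ∣ p − 1`) would also be «Hecke-trivialised at `W`», with a different `K(p)`-type.  The appended fact
`fullLevelHomology_isIsotypic_tamePrincipalSeries_of_central` adds the hypothesis that the CENTRE acts trivially on `V`; on the
centre-invariant part all normalisations agree (up to a power of `q`, excluded by the Hasse bound), so that fact is the printed
theorem whatever the sign.  The K-line's `V = ℚ_p ⊗ Λ_Q(f_D)` satisfies the extra hypothesis: the spread period map is constant on
left `T̃`-cosets (`PermutationCoeff.spread_apply_mul_left`) and `Z(GL₂(𝔽_p)) ⊆ T̃` is central, so `R_{diag(a,a)} F = F` on `Λ_Q(f_D)`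
(`funTranslate_central_eq`).  Hence

  **K ⟸ `exists_isNewformOf` ∧ `fullLevelHomology_isIsotypic_tamePrincipalSeries_of_central` (cite-only) ∧ (W‴).**

[cite: ConradDiamondTaylor1999, Lemma 4.2.4 (2), §5.3, Lemma 7.1.3 (2)] [cite: AshStevens1986, §1 (1.2)–(1.4)]
[cite: SerreLinearRepresentations1977, §2.6 Thm. 8 and §15.2] [cite: EdixhovenManin1991, §4]
-/

set_option autoImplicit false
-- single-conjunct summit: `Summit.BirchSwinnertonDyer.BirchSwinnertonDyer.…` repeats the name by design
set_option linter.dupNamespace false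

noncomputable section

open scoped Pointwise MatrixGroups TensorProduct

open Function CongruenceSubgroup
open Literature.RepresentationTheory.FiniteGroups Literature.RepresentationTheory.FiniteGroups.GL2
  Literature.NumberTheory.EllipticCurves.ModularForms
open Literature.NumberTheory.EllipticCurves (Kato2004.teichmullerChar)
open Literature.NumberTheory.ModularSymbols Literature.NumberTheory.ModularSymbols.FullLevel
open Literature.Algebra.Homology
open Literature.NumberTheory.Automorphic (TwistedQuotient.resScalars TwistedQuotient.resScalars_apply)

namespace Summit.BirchSwinnertonDyer.BirchSwinnertonDyer.Theorems.TeichmullerTwistDescent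

open WeierstrassCurve Literature.NumberTheory.EllipticCurves
open Summit.BirchSwinnertonDyer.BirchSwinnertonDyer.Theses.TeichmullerTwistDescent

namespace KOfTameType

section Central

variable (p : ℕ) [Fact p.Prime]

/-- Scalar matrices are central in `GL₂(𝔽_p)`: `g · diag(a,a) = diag(a,a) · g`. [cite: Bump1997, §4.1 Eq. (1.6)] -/
theorem mul_diagElt_self_comm (a : (ZMod p)ˣ) (g : GL (Fin 2) (ZMod p)) :
    g * diagElt (ZMod p) a a = diagElt (ZMod p) a a * g := by
  apply Matrix.GeneralLinearGroup.ext
  intro i j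
  rw [Units.val_mul, Units.val_mul, coe_diagElt]
  fin_cases i <;> fin_cases j <;> simp [Matrix.mul_apply, Fin.sum_univ_two, mul_comm]

variable (M : ℕ) [NeZero M] (hpM : Nat.Coprime p M)
  [Fintype (diagTorus (ZMod p))] [Invertible (Fintype.card (diagTorus (ZMod p)) : ℤ_[p])]

/-- **The centre of `GL₂(𝔽_p)` acts trivially on `Λ_Q(f)`**: right translation by `diag(a,a)` fixes every spread period
function, because the spread is constant on left `T̃`-cosets and `diag(a,a) ∈ T̃` is central.
[cite: AshStevens1986, §1 (1.2)–(1.3)] -/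
theorem funTranslate_central_eq (f : CuspForm (Gamma0 (p ^ 2 * M)) 2) (a : (ZMod p)ˣ)
    (F : spreadLattice ℤ_[p] p M hpM f) :
    funTranslate p (diagElt (ZMod p) a a) F.1 = F.1 := by
  obtain ⟨z, hz⟩ := F.2
  funext g
  change F.1 (g * diagElt (ZMod p) a a) = F.1 g
  rw [mul_diagElt_self_comm, ← hz]
  exact PermutationCoeff.spread_apply_mul_left (redGL p M) (diagTorus (ZMod p)) (torusPeriodClass ℤ_[p] p M hpM f)
    ⟨diagElt (ZMod p) a a, diagElt_mem_diagTorus p a a⟩ z g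

/-- **The centre acts trivially on `ℚ_p ⊗ Λ_Q(f)`** for the base change `σ` of the translation representation `ρ`
(`σ g (a ⊗ x) = a ⊗ ρ g x`, `ρ g F = R_g F`): immediate from `funTranslate_central_eq` on pure tensors.
[cite: AshStevens1986, §1 (1.2)–(1.3)] -/
theorem baseChange_central_eq (f : CuspForm (Gamma0 (p ^ 2 * M)) 2)
    (ρ : Representation ℤ_[p] (GL (Fin 2) (ZMod p)) (spreadLattice ℤ_[p] p M hpM f))
    (hρ : ∀ (g : GL (Fin 2) (ZMod p)) (F : spreadLattice ℤ_[p] p M hpM f),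
      ((ρ g F : spreadLattice ℤ_[p] p M hpM f) : GL (Fin 2) (ZMod p) → _) = funTranslate p g F.1)
    (σ : Representation ℚ_[p] (GL (Fin 2) (ZMod p)) (ℚ_[p] ⊗[ℤ_[p]] spreadLattice ℤ_[p] p M hpM f))
    (hσ : ∀ (g : GL (Fin 2) (ZMod p)) (a : ℚ_[p]) (x : spreadLattice ℤ_[p] p M hpM f),
      σ g (a ⊗ₜ[ℤ_[p]] x) = a ⊗ₜ[ℤ_[p]] ρ g x)
    (a : (ZMod p)ˣ) (v : ℚ_[p] ⊗[ℤ_[p]] spreadLattice ℤ_[p] p M hpM f) :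
    σ (diagElt (ZMod p) a a) v = v := by
  have hρa : ∀ F : spreadLattice ℤ_[p] p M hpM f, ρ (diagElt (ZMod p) a a) F = F :=
    fun F => Subtype.ext (by rw [hρ]; exact funTranslate_central_eq p M hpM f a F)
  induction v using TensorProduct.induction_on with
  | zero => exact map_zero _
  | tmul c F => rw [hσ, hρa]
  | add x y hx hy => rw [map_add, hx, hy]

end Central

/-! ### (I1ᴷ) from the central-character-pinned tame-type fact -/

set_option maxHeartbeats 400000 in
/-- **(I1ᴷ) from the central-character-pinned TYPE of the full-level homology.**  As
`tamePrincipalSeriesFunctionalOverField_of_tameType`, with the extra hypothesis of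
`fullLevelHomology_isIsotypic_tamePrincipalSeries_of_central` — the centre of `GL₂(𝔽_p)` acts trivially on
`V = ℚ_p ⊗ Λ_Q(f_D)` — discharged by `funTranslate_central_eq`.  BSD is not proved by this; (I1ᴷ) becomes CONDITIONAL on a cite-only
published fact whose truth does not depend on the normalisation of the tree's Hecke operators.
[cite: ConradDiamondTaylor1999, Lemma 4.2.4 (2), §5.3, Lemma 7.1.3 (2)] [cite: AshStevens1986, §1 (1.2)–(1.4)]
[cite: SerreLinearRepresentations1977, §2.6 Thm. 8, §15.2] -/
theorem tamePrincipalSeriesFunctionalOverField_of_tameTypeCentral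
    (hT : fullLevelHomology_isIsotypic_tamePrincipalSeries_of_central) : TamePrincipalSeriesFunctionalOverField := by
  intro p M _ _ _ hpM _ _ W _ _ hN D hp11 hadd hirr hGo hV4
  haveI : NeZero (p ^ 2 * M) := neZero_sq_mul p M
  have hp5 : 5 ≤ p := le_trans (by norm_num) hp11
  -- the fact's hypotheses from the prefix
  have hPGO : W.HasPotentiallyGoodOrdinaryReductionAtPrime p :=
    W.hasPotentiallyGoodOrdinaryReductionAtPrime_of_forall_intermediateField p Fact.out hGo
  have hv6 : padicValInt p W.minimalDiscriminantInt ≠ 6 := by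
    rcases TameExponent.padicValInt_mem W p hp5 hadd hV4 with h | h | h <;> omega
  have heb : 12 / Nat.gcd 12 (padicValInt p W.minimalDiscriminantInt) * tameExponent p W = p - 1 :=
    TameExponent.semistabilityIndex_mul_tameExponent W p hp5 hadd hGo hV4
  -- the lattice, its translation representation and the base change to `ℚ_p`
  haveI := KOfPrincipalSeriesFunctional.moduleFinite_spreadLattice p M hpM D.f
  obtain ⟨ρ, hρ⟩ := exists_translationRep p M hpM D.f
  obtain ⟨σ, hσ⟩ : ∃ σ : Representation ℚ_[p] (GL (Fin 2) (ZMod p)) (ℚ_[p] ⊗[ℤ_[p]] spreadLattice ℤ_[p] p M hpM D.f),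
      ∀ (g : GL (Fin 2) (ZMod p)) (a : ℚ_[p]) (x : spreadLattice ℤ_[p] p M hpM D.f),
        σ g (a ⊗ₜ[ℤ_[p]] x) = a ⊗ₜ[ℤ_[p]] ρ g x :=
    exists_baseChangeRep (A := ℚ_[p]) ρ
  -- `Φ = (1 ⊗ ·) ∘ spreadElt`
  let ι : spreadLattice ℤ_[p] p M hpM D.f →ₗ[ℤ_[p]] ℚ_[p] ⊗[ℤ_[p]] spreadLattice ℤ_[p] p M hpM D.f :=
    TensorProduct.mk ℤ_[p] ℚ_[p] (spreadLattice ℤ_[p] p M hpM D.f) 1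
  let Φ : H1carrier ℤ_[p] p M →ₗ[ℤ_[p]] ℚ_[p] ⊗[ℤ_[p]] spreadLattice ℤ_[p] p M hpM D.f :=
    ι.comp (LinearMap.rangeRestrict (spreadPeriod ℤ_[p] p M hpM D.f))
  have hΦ : ∀ z, Φ z = (1 : ℚ_[p]) ⊗ₜ[ℤ_[p]] spreadElt ℤ_[p] p M hpM D.f z := fun z => rfl
  -- `spreadElt` intertwines the carrier action with `ρ`
  have hρ' : ∀ (g : GL (Fin 2) (ZMod p)) (z : H1carrier ℤ_[p] p M),
      spreadElt ℤ_[p] p M hpM D.f (H1carrierRep ℤ_[p] p M g z) = ρ g (spreadElt ℤ_[p] p M hpM D.f z) := by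
    intro g z
    rw [spreadElt_H1carrierRep]
    exact Subtype.ext (hρ g (spreadElt ℤ_[p] p M hpM D.f z)).symm
  -- the centre acts trivially on `V`
  have hZ : ∀ (a : (ZMod p)ˣ) (v : ℚ_[p] ⊗[ℤ_[p]] spreadLattice ℤ_[p] p M hpM D.f),
      σ (diagElt (ZMod p) a a) v = v := baseChange_central_eq p M hpM D.f ρ hρ σ hσ
  -- equivariance of `Φ`
  have hG : ∀ (g : GL (Fin 2) (ZMod p)) (z : H1carrier ℤ_[p] p M), Φ (H1carrierRep ℤ_[p] p M g z) = σ g (Φ z) := by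
    intro g z
    rw [hΦ, hΦ, hρ', hσ]
  -- Hecke trivialisation of `Φ` at `W`
  have hTq : ∀ (q : ℕ) [NeZero q] (hq : q.Prime) (hqp : q ≠ p) (z : H1carrier ℤ_[p] p M),
      Φ (heckeT ℤ_[p] p M hq hqp z) = ((W.LFunction q : ℤ) : ℚ_[p]) • Φ z := by
    intro q _ hq hqp z
    have hTf : HeckeRing0.toEnd (p ^ 2 * M) 2 (HeckeRing0.T (p ^ 2 * M) 2 q hq) D.f = ((W.LFunction q : ℤ) : ℂ) • D.f := by
      have hcoef : (UpperHalfPlane.qExpansion 1 ⇑D.f).coeff q = ((W.LFunction q : ℤ) : ℂ) := D.isNewformOf.2 q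
      rw [HeckeRing0.toEnd_T, D.isNewformOf.1.heckeT_eq_coeff_smul hq, hcoef]
    have hsm : spreadElt ℤ_[p] p M hpM D.f (heckeT ℤ_[p] p M hq hqp z) =
        ((W.LFunction q : ℤ) : ℤ_[p]) • spreadElt ℤ_[p] p M hpM D.f z :=
      Subtype.ext (by rw [coe_spreadElt, spreadPeriod_heckeT ℤ_[p] p M hpM hq hqp hTf z, Submodule.coe_smul, coe_spreadElt])
    rw [hΦ, hΦ, hsm, Int.cast_smul_eq_zsmul, TensorProduct.tmul_smul, Int.cast_smul_eq_zsmul]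
  -- the image of `Φ` spans `V`
  have hspan : Submodule.span ℚ_[p] (Set.range Φ) = ⊤ := by
    rw [eq_top_iff]
    rintro v -
    induction v using TensorProduct.induction_on with
    | zero => exact Submodule.zero_mem _
    | tmul a F =>
      obtain ⟨z, hz⟩ := F.2
      have hF : F = spreadElt ℤ_[p] p M hpM D.f z := Subtype.ext hz.symm
      have hmem : (1 : ℚ_[p]) ⊗ₜ[ℤ_[p]] F ∈ Submodule.span ℚ_[p] (Set.range Φ) :=
        Submodule.subset_span ⟨z, by rw [hΦ, hF]⟩
      have := Submodule.smul_mem _ a hmem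
      rwa [TensorProduct.smul_tmul', smul_eq_mul, mul_one] at this
    | add x y hx hy => exact Submodule.add_mem _ hx hy
  -- the fact: `V` is isotypic of the tame principal-series type
  have hiso := hT p M W (tameExponent p W) hp5 hpM hN hPGO hv6 heb ℚ_[p]
    (ℚ_[p] ⊗[ℤ_[p]] spreadLattice ℤ_[p] p M hpM D.f) σ Φ hZ hG hTq hspan
  -- a nonzero vector of `V` in the image of `Φ`
  obtain ⟨z₀, hz₀⟩ := exists_spreadElt_ne_zero p M hpM D.f D.isNewformOf.1 D.isNewformOf.coeffField_eq_bot
  have hΦz₀ : Φ z₀ ≠ 0 := by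
    rw [hΦ]
    exact one_tmul_ne_zero (R := ℤ_[p]) (A := ℚ_[p]) (IsFractionRing.injective ℤ_[p] ℚ_[p]) hz₀
  -- Maschke + isotypy: a `ℚ_p[GL₂(𝔽_p)]`-linear map to the type seeing `Φ z₀`
  haveI : IsSemisimpleModule (MonoidAlgebra ℚ_[p] (GL (Fin 2) (ZMod p))) σ.asModule := inferInstance
  obtain ⟨θ, hθ⟩ := exists_linearMap_apply_ne_zero_of_isIsotypicOfType hiso (v := (Φ z₀ : σ.asModule)) hΦz₀
  -- back to an intertwining `ℚ_p`-linear map (kept opaque)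
  obtain ⟨θ', hθ'⟩ : ∃ θ' : σ.IntertwiningMap
      (coordRep (reduceChar ℚ_[p] (Kato2004.teichmullerChar p ^ (p - 1 - tameExponent p W)))
        (reduceChar ℚ_[p] (Kato2004.teichmullerChar p ^ tameExponent p W))), ∀ v, θ' v = θ v :=
    ⟨(Representation.IntertwiningMap.equivLinearMapAsModule _ _).symm θ, fun v => rfl⟩
  -- the functional `Ψ = θ' ∘ (1 ⊗ ·)`, kept opaque
  obtain ⟨Ψ, hΨ⟩ : ∃ Ψ : spreadLattice ℤ_[p] p M hpM D.f →ₗ[ℤ_[p]] (Option (ZMod p) → ℚ_[p]),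
      ∀ F, Ψ F = θ' ((1 : ℚ_[p]) ⊗ₜ[ℤ_[p]] F) :=
    ⟨(θ'.toLinearMap.restrictScalars ℤ_[p]).comp ι, fun F => rfl⟩
  refine ⟨ℚ_[p], inferInstance, inferInstance, inferInstance, inferInstance, Ψ, ?_, ?_⟩
  · -- equivariance (no `rw` with a `Subtype.mk`-headed pattern: go through `ρ g F`)
    intro F g
    have hFg : (⟨funTranslate p g F.1, spreadLattice_translate_mem ℤ_[p] p M hpM D.f g F.2⟩ :
        spreadLattice ℤ_[p] p M hpM D.f) = ρ g F := Subtype.ext (hρ g F).symm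
    have key : Ψ (ρ g F) =
        coordRep (reduceChar ℚ_[p] (Kato2004.teichmullerChar p ^ (p - 1 - tameExponent p W)))
          (reduceChar ℚ_[p] (Kato2004.teichmullerChar p ^ tameExponent p W)) g (Ψ F) := by
      have h2 := Representation.IntertwiningMap.isIntertwining _ _ θ' g ((1 : ℚ_[p]) ⊗ₜ[ℤ_[p]] F)
      rw [hσ g 1 F] at h2
      rw [hΨ, hΨ]
      exact h2
    rw [TwistedQuotient.resScalars_apply, ← key]
    exact congrArg Ψ hFg
  · -- nonvanishing
    intro h0
    apply hθ
    have h1 : Ψ (spreadElt ℤ_[p] p M hpM D.f z₀) = 0 := by rw [h0, LinearMap.zero_apply]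
    rw [hΨ, hθ', ← hΦ] at h1
    exact h1

/-! ### K and GE11 from modularity, the central-character-pinned tame-type fact and (W‴) -/

/-- **K from modularity, the central-character-pinned TAME-TYPE fact and the weight exclusion (W‴).**  Conclusion = the route
decl `TwistedPeriodLatticeSaturation` VERBATIM; BSD is not proved by this; K is proved CONDITIONALLY on modularity
(`exists_isNewformOf`), the cite-only fact `fullLevelHomology_isIsotypic_tamePrincipalSeries_of_central` and the route-posited
(W‴) `NoEtaleWeightEigenQuotient`. [cite: EdixhovenManin1991, §4] [cite: ConradDiamondTaylor1999, Lemma 4.2.4 (2), §5.3] -/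
theorem twistedPeriodLatticeSaturation_of_tameTypeCentral_of_noEtaleWeightEigenQuotient (hnf : exists_isNewformOf)
    (hT : fullLevelHomology_isIsotypic_tamePrincipalSeries_of_central) (hW : NoEtaleWeightEigenQuotient) :
    Summit.BirchSwinnertonDyer.BirchSwinnertonDyer.Theses.TeichmullerTwistDescent.TwistedPeriodLatticeSaturation :=
  KOfPrincipalSeriesFunctional.twistedPeriodLatticeSaturation_of_field_of_noEtaleWeightEigenQuotient hnf
    (tamePrincipalSeriesFunctionalOverField_of_tameTypeCentral hT) hW

/-- **GE11 from modularity, Edixhoven's Kodaira-type theorem, the central-character-pinned tame-type fact and (W‴).**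
`OrdinaryLowValuationOptimalManinUnitGeEleven` (route decl verbatim); BSD is not proved by this; GE11 is proved CONDITIONALLY on
the four named hypotheses. [cite: EdixhovenManin1991, §4 and Thm. 3] [cite: Stevens1989, Lemma (5.2)] -/
theorem ordinaryLowValuationOptimalManinUnitGeEleven_of_tameTypeCentral_inputs (hnf : exists_isNewformOf)
    (hEdix : edixhoven_not_dvd_maninConstant_of_kodairaSymbol_ne)
    (hT : fullLevelHomology_isIsotypic_tamePrincipalSeries_of_central) (hW : NoEtaleWeightEigenQuotient) :
    OrdinaryLowValuationOptimalManinUnitGeEleven :=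
  KOfPrincipalSeriesFunctional.ordinaryLowValuationOptimalManinUnitGeEleven_of_field_inputs hnf hEdix
    (tamePrincipalSeriesFunctionalOverField_of_tameTypeCentral hT) hW

end KOfTameType

end Summit.BirchSwinnertonDyer.BirchSwinnertonDyer.Theorems.TeichmullerTwistDescent
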